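import Mathlib
import Summits.KontsevichZagierPeriods.Zeta5Search.SecondOrderAssembly
import HarnessLib

/-!
# ζ(5) search — criterion C2*: the live coefficients and the orbit of a sub-deep class

Cell `pub-zeta5` (HONEST FRAMING: systematic search; no irrationality claim unless certified), typer seat generation 11.
REPORT-gen2-g10 §3, proof of THEOREM A‴ in its GENERAL form (tree statement `SecondOrder.SecondOrderCollinearity`): in the regime
"multipole classes of exponent `≥ −M`, single-pole classes `ν ≥ −M+1`, classes of exponent `−M` non-self-conjugate with PALINDROMIC type
list" (no hypothesis on the sub-deep classes), the sub-deep part of the second digit is carried by the ORBIT VECTORS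
`(orbitW, orbitV)` of the LIVE sub-deep classes: with the live coefficient `c_z = liveCoeff` (`ĝ_z` for a live class, halved when
its conjugate is a different live class, `0` otherwise), for every pole class `y` of exponent `−M+1`
`ĝ_yŵ_y + ĝ_ȳŵ_ȳ ≡ c_y orbit_W(y) + c_ȳ orbit_W(ȳ) (mod p)` and the same for `V` (`sub_pair_norm₂`; tame classes carry no digit,
`ĝ_ȳ ≡ ĝ_y`).  Nothing here bears on irrationality.
-/

noncomputable section

open Finset PowerSeries

namespace Summit.KontsevichZagierPeriods.Zeta5Search.SecondOrder

open Summit.KontsevichZagierPeriods.Zeta5Search.DualSeries (InBox)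
open Summit.KontsevichZagierPeriods.Zeta5Search.WedgeDictionary (coeffW coeffV)
open Summit.KontsevichZagierPeriods.Zeta5Search.CasoratianValuation (InPolytope)
open Summit.KontsevichZagierPeriods.Zeta5Search.ClusterValuation
open Summit.KontsevichZagierPeriods.Zeta5Search.PadicSeries
open Summit.KontsevichZagierPeriods.Zeta5Search.CellA (classW coeffW_eq_sum_classW padicNorm_p padicNorm_classRho_le_one
  padicNorm_harm_le_one padicNorm_pow_eq)
open Literature.NumberTheory.Transcendental.BallRivoal (harm)

variable {p : ℕ} [hp : Fact p.Prime]

/-! ## §1 The live coefficient -/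

/-- The LIVE COEFFICIENT of the residue `z`: `0` unless `z` is a live pole class (`ν_z = −M+1`); then `ĝ_z`, halved when the conjugate
class is a different live class (the orbit `{z, z̄}` is then counted from both of its members). -/
def liveCoeff (b : ℕ → ℤ) (p M z : ℕ) : ℚ :=
  if 1 ≤ classPoleCount b p z ∧ classNu b p z = -(M : ℤ) + 1 then
    (if CentreIn b p z ∨ classNu b p (conjClass b p z) ≠ -(M : ℤ) + 1 then gHat b p z else gHat b p z / 2)
  else 0

/-- `‖c_z‖ ≤ 1`. -/
theorem padicNorm_liveCoeff_le (b : ℕ → ℤ) (M z : ℕ) (hg : padicNorm p (gHat b p z) ≤ 1) (hp2 : p ≠ 2) :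
    padicNorm p (liveCoeff b p M z) ≤ 1 := by
  unfold liveCoeff; split_ifs
  · exact hg
  · rw [padicNorm.div, padicNorm_two hp2, div_one]; exact hg
  · simp

omit hp in
/-- A residue with a non-zero live coefficient is a live pole class. -/
theorem liveCoeff_ne_zero {b : ℕ → ℤ} {M z : ℕ} (h : liveCoeff b p M z ≠ 0) :
    1 ≤ classPoleCount b p z ∧ classNu b p z = -(M : ℤ) + 1 := by
  by_contra hn; apply h; unfold liveCoeff; rw [if_neg hn]

/-! ## §2 The orbit of a sub-deep class -/

section SubPair

variable (b : ℕ → ℤ) (hb : InPolytope b) (hp5 : 5 ≤ p) (hpn : (p : ℤ) ≤ b 0) (hwin : (b 0 + 2 : ℤ) < (p : ℤ) ^ 2)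
  {M : ℕ} (hM : 6 ≤ M) (hMe : Even M)
include hb hp5 hpn hwin hM hMe

/-- **The pair of a sub-deep class is carried by the orbit vectors of its live members**: for a pole class `y` of exponent `−M+1`,
`‖ĝ_yŵ_y + ĝ_ȳŵ_ȳ − (c_y orbit_W(y) + c_ȳ orbit_W(ȳ))‖ ≤ p⁻¹`, and the same for `V`. -/
theorem sub_pair_norm₂ {y : ℕ} (hy : y < p) (hpole : 1 ≤ classPoleCount b p y) (hE : classExp b p y = -(M : ℤ) + 1) :
    padicNorm p (gHat b p y * wHat b p y + gHat b p (conjClass b p y) * wHat b p (conjClass b p y)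
        - (liveCoeff b p M y * orbitW b p y + liveCoeff b p M (conjClass b p y) * orbitW b p (conjClass b p y)))
        ≤ (p : ℚ) ^ (-(1 : ℤ)) ∧
      padicNorm p (gHat b p y * vHat b p y + gHat b p (conjClass b p y) * vHat b p (conjClass b p y)
        - (liveCoeff b p M y * orbitV b p y + liveCoeff b p M (conjClass b p y) * orbitV b p (conjClass b p y)))
        ≤ (p : ℚ) ^ (-(1 : ℤ)) := by
  have h0 : 0 ≤ b 0 := hb.1.1
  have hp0 : 0 < p := hp.out.pos
  have hp2 : p ≠ 2 := by omega
  have hp1 : (1 : ℚ) ≤ p := one_le_p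
  obtain ⟨-, -, -, hn⟩ := thmA_data b hb hwin
  have hpn' : p ≤ (b 0).toNat := by have := hb.1.1; omega
  have hyn : y ≤ (b 0).toNat := le_b0_of_lt b hpn hy
  obtain ⟨hL, hL'⟩ := level_bounds' (p := p) b hyn
  have hyc' : conjClass b p y < p := conjClass_lt b hp0 y
  have hEc : classExp b p (conjClass b p y) = -(M : ℤ) + 1 := by rw [classExp_conj b h0 hyn]; exact hE
  have hpolec : 1 ≤ classPoleCount b p (conjClass b p y) := by rw [classPoleCount_conj b h0 hyn]; exact hpole
  have hcc : conjClass b p (conjClass b p y) = y := conjClass_conjClass b hy hpn'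
  have hw1 : ∀ z, padicNorm p (wHat b p z) ≤ 1 := fun z => LevelClass.padicNorm_wHat_le_one b h0 hn hp2 z
  have hv1 : ∀ z, padicNorm p (vHat b p z) ≤ 1 := fun z => LevelClass.padicNorm_vHat_le_one b h0 hn hp2
  have h2n : padicNorm p (2 : ℚ) = 1 := padicNorm_two hp2
  have hhalf : padicNorm p ((1 : ℚ) / 2) = 1 := by rw [padicNorm.div, padicNorm.one, h2n, div_one]
  -- `ĝ_ȳ ≡ ĝ_y`
  have hgg : padicNorm p (gHat b p (conjClass b p y) - gHat b p y) ≤ (p : ℚ) ^ (-(1 : ℤ)) := by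
    by_cases hc : CentreIn b p y
    · rw [(centreIn_iff_conjClass_eq b hpn' hy).1 hc, sub_self, padicNorm.zero]; exact zpow_p_nonneg _
    · have hodd : Odd (classExp b p y) := by
        rw [hE]; obtain ⟨r, hr⟩ := hMe; exact ⟨-(r : ℤ), by omega⟩
      exact gHat_pair_first b hb hp5 hy hL hL' hc hodd
  have hsmall : ∀ {a c : ℚ}, padicNorm p a ≤ (p : ℚ) ^ (-(1 : ℤ)) → padicNorm p c ≤ 1 →
      padicNorm p (a * c) ≤ (p : ℚ) ^ (-(1 : ℤ)) := fun ha hc => by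
    rw [padicNorm.mul]
    calc _ ≤ (p : ℚ) ^ (-(1 : ℤ)) * 1 := mul_le_mul ha hc (padicNorm.nonneg _) (zpow_p_nonneg _)
      _ = _ := mul_one _
  have hdiff1 : ∀ {u u' : ℚ}, padicNorm p u ≤ 1 → padicNorm p u' ≤ 1 → padicNorm p (u - u') ≤ 1 :=
    fun hu hu' => (padicNorm.sub (p := p)).trans (max_le hu hu')
  -- the orbit vectors, unfolded
  have hoWc : CentreIn b p y → orbitW b p y = wHat b p y := fun hc => by unfold orbitW; rw [if_pos hc]
  have hoVc : CentreIn b p y → orbitV b p y = vHat b p y := fun hc => by unfold orbitV; rw [if_pos hc]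
  have hoW : ¬ CentreIn b p y → orbitW b p y = wHat b p y + wHat b p (conjClass b p y) := fun hc => by
    unfold orbitW; rw [if_neg hc]; rfl
  have hoV : ¬ CentreIn b p y → orbitV b p y = vHat b p y + vHat b p (conjClass b p y) := fun hc => by
    unfold orbitV; rw [if_neg hc]; rfl
  have hoW' : ¬ CentreIn b p (conjClass b p y) →
      orbitW b p (conjClass b p y) = wHat b p (conjClass b p y) + wHat b p y := fun hc => by
    unfold orbitW; rw [if_neg hc]; exact congrArg _ (congrArg _ hcc)
  have hoV' : ¬ CentreIn b p (conjClass b p y) →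
      orbitV b p (conjClass b p y) = vHat b p (conjClass b p y) + vHat b p y := fun hc => by
    unfold orbitV; rw [if_neg hc]; exact congrArg _ (congrArg _ hcc)
  by_cases hly : classNu b p y = -(M : ℤ) + 1 <;> by_cases hlc : classNu b p (conjClass b p y) = -(M : ℤ) + 1
  · -- both live
    by_cases hcen : CentreIn b p y
    · -- the self-conjugate class
      have hself : conjClass b p y = y := (centreIn_iff_conjClass_eq b hpn' hy).1 hcen
      have hc : liveCoeff b p M y = gHat b p y := by
        unfold liveCoeff; rw [if_pos ⟨hpole, hly⟩, if_pos (Or.inl hcen)]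
      rw [hself, hc, hoWc hcen, hoVc hcen, sub_self, sub_self, padicNorm.zero]
      exact ⟨zpow_p_nonneg _, zpow_p_nonneg _⟩
    · have hcenc : ¬ CentreIn b p (conjClass b p y) := fun h => hcen ((centreIn_conj_iff b h0 hyn).1 h)
      have hc : liveCoeff b p M y = gHat b p y / 2 := by
        unfold liveCoeff; rw [if_pos ⟨hpole, hly⟩, if_neg (not_or.2 ⟨hcen, fun h => h hlc⟩)]
      have hc' : liveCoeff b p M (conjClass b p y) = gHat b p (conjClass b p y) / 2 := by
        unfold liveCoeff; rw [hcc, if_pos ⟨hpolec, hlc⟩, if_neg (not_or.2 ⟨hcenc, fun h => h hly⟩)]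
      rw [hc, hc', hoW hcen, hoV hcen, hoW' hcenc, hoV' hcenc]
      have eW : gHat b p y * wHat b p y + gHat b p (conjClass b p y) * wHat b p (conjClass b p y)
          - (gHat b p y / 2 * (wHat b p y + wHat b p (conjClass b p y))
            + gHat b p (conjClass b p y) / 2 * (wHat b p (conjClass b p y) + wHat b p y)) =
          (1 : ℚ) / 2 * ((gHat b p (conjClass b p y) - gHat b p y) * (wHat b p (conjClass b p y) - wHat b p y)) := by ring
      have eV : gHat b p y * vHat b p y + gHat b p (conjClass b p y) * vHat b p (conjClass b p y)
          - (gHat b p y / 2 * (vHat b p y + vHat b p (conjClass b p y))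
            + gHat b p (conjClass b p y) / 2 * (vHat b p (conjClass b p y) + vHat b p y)) =
          (1 : ℚ) / 2 * ((gHat b p (conjClass b p y) - gHat b p y) * (vHat b p (conjClass b p y) - vHat b p y)) := by ring
      rw [eW, eV, padicNorm.mul, hhalf, one_mul, padicNorm.mul (q := (1 : ℚ) / 2), hhalf, one_mul]
      exact ⟨hsmall hgg (hdiff1 (hw1 _) (hw1 _)), hsmall hgg (hdiff1 (hv1 _) (hv1 _))⟩
  · -- `y` live, `ȳ` tame
    have hcen : ¬ CentreIn b p y := fun h => hlc (by rw [(centreIn_iff_conjClass_eq b hpn' hy).1 h]; exact hly)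
    have hc : liveCoeff b p M y = gHat b p y := by
      unfold liveCoeff; rw [if_pos ⟨hpole, hly⟩, if_pos (Or.inr hlc)]
    have hc' : liveCoeff b p M (conjClass b p y) = 0 := by
      unfold liveCoeff; rw [if_neg (fun h => hlc h.2)]
    rw [hc, hc', hoW hcen, hoV hcen, zero_mul, add_zero, zero_mul, add_zero]
    have eW : gHat b p y * wHat b p y + gHat b p (conjClass b p y) * wHat b p (conjClass b p y)
        - gHat b p y * (wHat b p y + wHat b p (conjClass b p y)) =
        (gHat b p (conjClass b p y) - gHat b p y) * wHat b p (conjClass b p y) := by ring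
    have eV : gHat b p y * vHat b p y + gHat b p (conjClass b p y) * vHat b p (conjClass b p y)
        - gHat b p y * (vHat b p y + vHat b p (conjClass b p y)) =
        (gHat b p (conjClass b p y) - gHat b p y) * vHat b p (conjClass b p y) := by ring
    rw [eW, eV]
    exact ⟨hsmall hgg (hw1 _), hsmall hgg (hv1 _)⟩
  · -- `y` tame, `ȳ` live
    have hcenc : ¬ CentreIn b p (conjClass b p y) := fun h =>
      hly (by rw [← hcc, (centreIn_iff_conjClass_eq b hpn' hyc').1 h]; exact hlc)
    have hc : liveCoeff b p M y = 0 := by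
      unfold liveCoeff; rw [if_neg (fun h => hly h.2)]
    have hc' : liveCoeff b p M (conjClass b p y) = gHat b p (conjClass b p y) := by
      unfold liveCoeff; rw [hcc, if_pos ⟨hpolec, hlc⟩, if_pos (Or.inr hly)]
    rw [hc, hc', hoW' hcenc, hoV' hcenc, zero_mul, zero_add, zero_mul, zero_add]
    have eW : gHat b p y * wHat b p y + gHat b p (conjClass b p y) * wHat b p (conjClass b p y)
        - gHat b p (conjClass b p y) * (wHat b p (conjClass b p y) + wHat b p y) =
        (gHat b p (conjClass b p y) - gHat b p y) * (-wHat b p y) := by ring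
    have eV : gHat b p y * vHat b p y + gHat b p (conjClass b p y) * vHat b p (conjClass b p y)
        - gHat b p (conjClass b p y) * (vHat b p (conjClass b p y) + vHat b p y) =
        (gHat b p (conjClass b p y) - gHat b p y) * (-vHat b p y) := by ring
    rw [eW, eV]
    exact ⟨hsmall hgg (by rw [padicNorm.neg]; exact hw1 _), hsmall hgg (by rw [padicNorm.neg]; exact hv1 _)⟩
  · -- both tame: no digit
    have hc : liveCoeff b p M y = 0 := by
      unfold liveCoeff; rw [if_neg (fun h => hly h.2)]
    have hc' : liveCoeff b p M (conjClass b p y) = 0 := by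
      unfold liveCoeff; rw [if_neg (fun h => hlc h.2)]
    obtain ⟨h1, h0y⟩ := tame_of_classNu_ne b (p := p) (x := y) (by rw [hE]; exact hly)
    obtain ⟨h1c, h0c⟩ := tame_of_classNu_ne b (p := p) (x := conjClass b p y) (by rw [hEc]; exact hlc)
    obtain ⟨hwy, hvy⟩ := tame_digits_norm b hb hp5 hwin hy h1 (by omega) h0y
    obtain ⟨hwc, hvc⟩ := tame_digits_norm b hb hp5 hwin hyc' h1c (by omega) h0c
    rw [hc, hc', zero_mul, zero_mul, add_zero, sub_zero, zero_mul, zero_mul, add_zero, sub_zero]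
    exact ⟨(padicNorm.nonarchimedean (p := p)).trans (max_le hwy hwc),
      (padicNorm.nonarchimedean (p := p)).trans (max_le hvy hvc)⟩

end SubPair

end Summit.KontsevichZagierPeriods.Zeta5Search.SecondOrder

end
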